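import Mathlib
import Literature.Computability.Complexity.FixedDimILPMachineA
import Literature.Algebra.EuclideanLattices.BabaiListMachine
import Literature.Algebra.EuclideanLattices.LatticeTableCodeFP
import HarnessLib

/-!
# Lenstra's algorithm in fixed dimension, XIII: the list program is polynomial time, part B (lattice step, recursion)

Topic `Computability/Complexity`, grouping namespace `FixedDimILP`; sequel of `FixedDimILPMachineA.lean`.
Typed polynomial time for steps 4–7 of the list program of `FixedDimILPPrograms.lean` and for the whole
recursion `decideL N`, by induction on the fixed dimension `N`: the LLL step is the tree's machine
(`latticeTableFP`, `SimApproxLLL.lllOutFP`, `flatFP`), Babai's coefficients are `Babai.coeffsL_codeFP`, and the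
`≤ |V| · (2^{N+1}(N+1)³ + 1)` recursive calls of dimension `N - 1` are an `any` over the data composed with the
polynomial-time function of dimension `N - 1` (induction hypothesis) — polynomial time is closed under
composition, so no running-time estimate is written anywhere.

* `latRows_codeFP`, `shiftL_codeFP`, `targetL_codeFP`, **`lllRowsL_codeFP`**, `transU_codeFP` (`colOf` on codes is the
  tree's `column_codeFP`), **`babaiPoint_codeFP`**, `sectionRowsL_codeFP`, `levelsOfAnchor_eq` / `levelsOfAnchor_codeFP`;
* **`decideL_codeFP`** (all `N`), **`decideInstL_codeFP`**.

## References

* S. Arora, B. Barak, *Computational Complexity: A Modern Approach*, CUP 2009, §1.3. [AroraBarak2009]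
* A. K. Lenstra, H. W. Lenstra, L. Lovász, Math. Ann. 261 (1982), Prop. 1.26 (LLL is polynomial). [LenstraLenstraLovasz1982]
* L. Babai, Combinatorica 6 (1986), §3 (nearest plane is polynomial). [Babai1986]
* H. W. Lenstra, Jr., Math. Oper. Res. 8 (1983), §1 (a bounded number of lower-dimensional problems). [LenstraHW1983]
-/

namespace Literature.Computability.Complexity

namespace FixedDimILP

open _root_.Computability CodeFP Literature.Algebra.EuclideanLattices Literature.Algebra.EuclideanLattices.GSInverse
  IntDetFP Literature.Computability.QuantumComplexity Literature.Algebra.EuclideanLattices.SimApproxLLL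

variable {σ α : Type} {eσ : σ → List Bool} {eα : α → List Bool}

/-! ### Step 4: the lattice and the centre -/

/-- `latRows N` on codes. [cite: AroraBarak2009, §1.3] -/
theorem latRows_codeFP (N : ℕ) : CodeFP candE lmatE (latRows N) := by
  have hc : CodeFP candE intE (fun cand => ((N : ℤ) + 1) * (denomProd cand : ℤ)) :=
    (intMul.comp ((const _ ((N : ℤ) + 1)).pair (intOfNat.comp denomProd_codeFP)) :)
  have hitem : CodeFP (pairE intE intE) intE (fun q => q.1 * q.2) := intMul
  have hrow : CodeFP (pairE intE (rawE intE)) (rawE intE) (fun q => q.2.map fun z => q.1 * z) :=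
    (map (σ := ℤ) (eσ := intE) (eα := intE) (eβ := intE) hitem :)
  have hrows := map (σ := ℤ) (eσ := intE) (eα := rawE intE) (eβ := rawE intE) hrow
  exact ((hrows.comp (hc.pair (gRows_codeFP N))).congr fun cand => rfl)

/-- `shiftL N` on codes. [folklore] -/
theorem shiftL_codeFP (N : ℕ) : CodeFP candE (rawE intE) (shiftL N) := by
  have hP0 : CodeFP candE (rawE intE) (fun cand => numer cand 0) := (numer_codeFP.comp ((CodeFP.id _).pair (const _ 0)) :)
  have hitem : CodeFP (pairE (rawE intE) (rawE intE)) intE (fun q => ((N : ℤ) + 1) * dotZ q.1 q.2) :=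
    (intMul.comp ((const _ ((N : ℤ) + 1)).pair dotZ_codeFP) :)
  have hmap := map (σ := List ℤ) (eσ := rawE intE) (eα := rawE intE) (eβ := intE) hitem
  exact ((hmap.comp (hP0.pair (invDataEdge_codeFP N).snd')).congr fun cand => rfl)

/-- `targetL N` on codes. [folklore] -/
theorem targetL_codeFP (N : ℕ) : CodeFP candE (rawE intE) (targetL N) := by
  have hitem : CodeFP (pairE intE intE) intE (fun q => q.1 + q.2) := intAdd
  have hmap := map (σ := ℤ) (eσ := intE) (eα := intE) (eβ := intE) hitem
  exact ((hmap.comp ((delta2_codeFP N).pair (shiftL_codeFP N))).congr fun cand => rfl)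

/-! ### Step 5: LLL and the transition matrices -/

/-- **`lllRowsL N` on codes**: build the instance code (`latticeTableFP`), run the tree's LLL machine
(`lllOutFP`), read the entries (`flatFP`) and cut them into the `N` rows. [cite: LenstraLenstraLovasz1982, Prop. 1.26] [cite: AroraBarak2009, §1.3] -/
theorem lllRowsL_codeFP (N : ℕ) : CodeFP lmatE lmatE (lllRowsL N) := by
  have hinst : CodeFP lmatE LatticeInstance.encode (fun B => (⟨N, LMat.toMat N N B⟩ : LatticeInstance)) :=
    ((latticeTableFP.comp ((unConstFP _ N).pair (CodeFP.id _))).recodeOut fun _ => rfl :)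
  have hflat : CodeFP lmatE (rawE intE) (fun B => flatOf (lllOut ⟨N, LMat.toMat N N B⟩)) := by
    have h : CodeFP lmatE (rawE smE) (fun B => flatOf (lllOut ⟨N, LMat.toMat N N B⟩)) :=
      ((rawOfList smE).comp (flatFP.comp (lllOutFP.comp hinst)).snd' :)
    exact ((map₀ intOfSM).comp h).congr fun B => by simp
  -- cut row `i`: `(E.drop (i N)).take N`
  have hcut : CodeFP (pairE (rawE intE) natE) (rawE intE) (fun q => (q.1.drop (q.2 * N)).take N) := by
    have hcount : CodeFP (pairE (rawE intE) natE) unE (fun q => min (q.2 * N) q.1.length) :=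
      (unOfNatMin.comp (((ulength intE).comp (fst _ _)).pair (natMul.comp ((snd _ _).pair (const _ N)))) :)
    have hdrop : CodeFP (pairE (rawE intE) natE) (rawE intE) (fun q => q.1.drop (min (q.2 * N) q.1.length)) :=
      ((rawDropUn intE).comp (hcount.pair (fst _ _)) :)
    have htake : CodeFP (pairE (rawE intE) natE) (rawE intE) (fun q => (q.1.drop (min (q.2 * N) q.1.length)).take N) :=
      ((rawTakeUn intE).comp ((unConstFP _ N).pair hdrop) :)
    exact htake.congr fun q => by rw [GSInverse.drop_min_length]
  have hrows := map (σ := List ℤ) (eσ := rawE intE) (eα := natE) (eβ := rawE intE) hcut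
  exact ((hrows.comp (hflat.pair (rangeConstFP _ N))).congr fun B => rfl)

/-- `transU` on codes: `(B₁, B₀) ↦ ((B₁)ᵢ · (invCols B₀)ⱼ / invDen B₀)ᵢⱼ`. [cite: AroraBarak2009, §1.3] -/
theorem transU_codeFP : CodeFP (pairE lmatE lmatE) lmatE (fun q => transU q.1 q.2) := by
  -- item `((row, den), col) ↦ dotZ row col / den`
  have hentry : CodeFP (pairE (pairE (rawE intE) intE) (rawE intE)) intE (fun q => dotZ q.1.1 q.2 / q.1.2) :=
    (intEDiv.comp ((dotZ_codeFP.comp ((fst _ _).fst'.pair (snd _ _))).pair (fst _ _).snd') :)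
  have hrow := map (σ := List ℤ × ℤ) (eσ := pairE (rawE intE) intE) (eα := rawE intE) (eβ := intE) hentry
  -- row of `U`: context `(den, cols)`, item `row`
  have hrowU : CodeFP (pairE (pairE intE lmatE) (rawE intE)) (rawE intE)
      (fun q => q.1.2.map fun col => dotZ q.2 col / q.1.1) :=
    (hrow.comp (((snd _ _).pair (fst _ _).fst').pair (fst _ _).snd') :)
  have hrows := map (σ := ℤ × List (List ℤ)) (eσ := pairE intE lmatE) (eα := rawE intE) (eβ := rawE intE) hrowU
  exact ((hrows.comp ((invData_codeFP.comp (snd _ _)).pair (fst _ _))).congr fun q => rfl)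

/-! ### Step 6: Babai's point -/

/-- **`babaiPoint N` on codes**: `((B₁, U), t) ↦ (z · colⱼ U)ⱼ`, `z = coeffsL B₁ t` (tree `coeffsL_codeFP`).
[cite: Babai1986, §3] [cite: AroraBarak2009, §1.3] -/
theorem babaiPoint_codeFP (N : ℕ) : CodeFP (pairE (pairE lmatE lmatE) (rawE intE)) (rawE intE) (fun q => babaiPoint N q.1.1 q.1.2 q.2) := by
  let C := pairE (pairE lmatE lmatE) (rawE intE)
  have hz : CodeFP C (rawE intE) (fun q => Babai.coeffsL q.1.1 q.2) := (Babai.coeffsL_codeFP.comp ((fst _ _).fst'.pair (snd _ _)) :)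
  have hitem : CodeFP (pairE (pairE (rawE intE) lmatE) natE) intE (fun q => dotZ q.1.1 (colOf q.1.2 q.2)) :=
    (dotZ_codeFP.comp ((fst _ _).fst'.pair (column_codeFP.comp ((fst _ _).snd'.pair (snd _ _)))) :)
  have hmap := map (σ := List ℤ × List (List ℤ)) (eσ := pairE (rawE intE) lmatE) (eα := natE) (eβ := intE) hitem
  exact ((hmap.comp ((hz.pair (fst _ _).snd').pair (rangeConstFP _ N))).congr fun q => rfl)

/-! ### Step 7: sections and levels -/

/-- `sectionRowsL N` on codes: `((rows, U), κ) ↦` the sectioned rows. [cite: AroraBarak2009, §1.3] -/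
theorem sectionRowsL_codeFP (N : ℕ) : CodeFP (pairE (pairE (rawE rowE) lmatE) intE) (rawE rowE) (fun q => sectionRowsL N q.1.1 q.1.2 q.2) := by
  let C := pairE (pairE (rawE rowE) lmatE) intE
  have hUtake : CodeFP C lmatE (fun q => q.1.2.take (N - 1)) := ((rawTakeUn (rawE intE)).comp ((unConstFP _ (N - 1)).pair (fst _ _).snd') :)
  have hUlast : CodeFP C (rawE intE) (fun q => q.1.2.getD (N - 1) []) :=
    ((rawGetD (rawE intE) (d := ([] : List ℤ)) rfl).comp ((fst _ _).snd'.pair (const _ (N - 1))) :)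
  -- item: context `((Utake, Ulast), κ)`, row `r`
  let D := pairE (pairE lmatE (rawE intE)) intE
  have hdots : CodeFP (pairE (rawE intE) lmatE) (rawE intE) (fun q => q.2.map fun u => dotZ q.1 u) :=
    (map (σ := List ℤ) (eσ := rawE intE) (eα := rawE intE) (eβ := intE) dotZ_codeFP :)
  have hitem : CodeFP (pairE D rowE) rowE
      (fun q => (q.1.1.1.map fun u => dotZ q.2.1 u, q.2.2 - q.1.2 * dotZ q.2.1 q.1.1.2)) := by
    have h1 : CodeFP (pairE D rowE) (rawE intE) (fun q => q.1.1.1.map fun u => dotZ q.2.1 u) :=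
      (hdots.comp ((snd _ _).fst'.pair (fst _ _).fst'.fst') :)
    have h2 : CodeFP (pairE D rowE) intE (fun q => q.2.2 - q.1.2 * dotZ q.2.1 q.1.1.2) :=
      (intSub.comp ((snd _ _).snd'.pair (intMul.comp ((fst _ _).snd'.pair (dotZ_codeFP.comp ((snd _ _).fst'.pair (fst _ _).fst'.snd'))))) :)
    exact h1.pair h2
  have hmap := map (σ := (List (List ℤ) × List ℤ) × ℤ) (eσ := D) (eα := rowE) (eβ := rowE) hitem
  exact ((hmap.comp (((hUtake.pair hUlast).pair (snd _ _)).pair (fst _ _).fst')).congr fun q => rfl)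

/-- `flatMap` of singletons is `map` (the shape of Lean's coercion `List ℕ → List ℤ`). [folklore] -/
theorem flatMap_singleton_eq_map {β γ : Type} (f : β → γ) (l : List β) : l.flatMap (fun a => [f a]) = l.map f := by
  induction l with
  | nil => rfl
  | cons a l ih => rw [List.flatMap_cons, List.map_cons, ih]; rfl

/-- `levelsOfAnchor` with the coercion `ℕ → ℤ` made explicit (its definition coerces the LIST
`List.range (slices N)`). [folklore] -/
theorem levelsOfAnchor_eq {N : ℕ} (c : List ℤ) (v : LVert) :
    levelsOfAnchor N c v = (List.range (slices N)).map fun j : ℕ => ceilDiv (dotZ c v.1) v.2 + (j : ℤ) := by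
  simp only [levelsOfAnchor, List.bind_eq_flatMap, List.pure_def, flatMap_singleton_eq_map, List.map_map]
  rfl

/-- Membership in `levelsOfAnchor`. [folklore] -/
theorem mem_levelsOfAnchor_iff {N : ℕ} {c : List ℤ} {v : LVert} {κ : ℤ} :
    κ ∈ levelsOfAnchor N c v ↔ ∃ j : ℕ, j < slices N ∧ κ = ceilDiv (dotZ c v.1) v.2 + j := by
  rw [levelsOfAnchor_eq, List.mem_map]
  constructor
  · rintro ⟨j, hj, rfl⟩; exact ⟨j, List.mem_range.1 hj, rfl⟩
  · rintro ⟨j, hj, rfl⟩; exact ⟨j, List.mem_range.2 hj, rfl⟩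

/-- `ceilDiv` on codes. [folklore] -/
theorem ceilDiv_codeFP : CodeFP (pairE intE intE) intE (fun q => ceilDiv q.1 q.2) :=
  (intNeg.comp (intEDiv.comp ((intNeg.comp (fst _ _)).pair (snd _ _)))).congr fun _ => rfl

/-- `levelsOfAnchor N` on codes: `(c, v) ↦ (⌈c · p / d⌉ + j)_{j < slices N}`. [folklore] -/
theorem levelsOfAnchor_codeFP (N : ℕ) : CodeFP (pairE (rawE intE) vertE) (rawE intE) (fun q => levelsOfAnchor N q.1 q.2) := by
  have hbase : CodeFP (pairE (rawE intE) vertE) intE (fun q => ceilDiv (dotZ q.1 q.2.1) q.2.2) :=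
    (ceilDiv_codeFP.comp ((dotZ_codeFP.comp ((fst _ _).pair (snd _ _).fst')).pair (intOfNat.comp (snd _ _).snd')) :)
  have hitem : CodeFP (pairE intE natE) intE (fun q => q.1 + (q.2 : ℤ)) := (intAdd.comp ((fst _ _).pair (intOfNat.comp (snd _ _))) :)
  have hmap := map (σ := ℤ) (eσ := intE) (eα := natE) (eβ := intE) hitem
  exact ((hmap.comp (hbase.pair (rangeConstFP _ (slices N)))).congr fun q => (levelsOfAnchor_eq q.1 q.2).symm)

/-! ### The recursion -/

/-- **`decideL N` is computed on codes by a polynomial-time string function, for every `N`** (induction on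
`N`; the recursive calls are an `any` composed with the function of dimension `N - 1`).
[cite: LenstraHW1983, §1] [cite: AroraBarak2009, §1.3] -/
theorem decideL_codeFP : ∀ N : ℕ, CodeFP (rawE rowE) bitE (decideL N)
  | 0 => by
    have hitem : CodeFP (pairE (rawE rowE) rowE) bitE (fun q => decide (0 ≤ q.2.2)) :=
      (intLe.comp ((const _ (0 : ℤ)).pair (snd _ _).snd') :)
    have hall := all (σ := List LRow) (eσ := rawE rowE) (eα := rowE) hitem
    exact ((hall.comp ((CodeFP.id _).pair (CodeFP.id _))).congr fun rows => by rw [decideL_zero]; rfl)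
  | N' + 1 => by
    let N := N' + 1
    let R := rawE rowE
    have hV : CodeFP R (rawE vertE) (fun rows => verticesL N (thickenL rows)) := ((verticesL_codeFP N).comp thickenL_codeFP :)
    have hgood : CodeFP R (rawE candE) (fun rows => goodTuples N (verticesL N (thickenL rows))) := ((goodTuples_codeFP N).comp hV :)
    have hempty : CodeFP R bitE (fun rows => (goodTuples N (verticesL N (thickenL rows))).isEmpty) := ((rawIsEmpty candE).comp hgood :)
    have hcand : CodeFP R candE (fun rows => (goodTuples N (verticesL N (thickenL rows))).headD []) :=
      ((rawHeadD candE (d := ([] : List LVert)) rfl).comp hgood :)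
    have hB₀ : CodeFP R lmatE (fun rows => latRows N ((goodTuples N (verticesL N (thickenL rows))).headD [])) :=
      ((latRows_codeFP N).comp hcand :)
    have hB₁ : CodeFP R lmatE (fun rows => lllRowsL N (latRows N ((goodTuples N (verticesL N (thickenL rows))).headD []))) :=
      ((lllRowsL_codeFP N).comp hB₀ :)
    have hU : CodeFP R lmatE (fun rows => transU (lllRowsL N (latRows N ((goodTuples N (verticesL N (thickenL rows))).headD [])))
        (latRows N ((goodTuples N (verticesL N (thickenL rows))).headD []))) := (transU_codeFP.comp (hB₁.pair hB₀) :)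
    have hc : CodeFP R (rawE intE) (fun rows => colOf (transU (latRows N ((goodTuples N (verticesL N (thickenL rows))).headD []))
        (lllRowsL N (latRows N ((goodTuples N (verticesL N (thickenL rows))).headD [])))) N') :=
      (column_codeFP.comp ((transU_codeFP.comp (hB₀.pair hB₁)).pair (const _ N')) :)
    have hx : CodeFP R (rawE intE) (fun rows => babaiPoint N (lllRowsL N (latRows N ((goodTuples N (verticesL N (thickenL rows))).headD [])))
        (transU (lllRowsL N (latRows N ((goodTuples N (verticesL N (thickenL rows))).headD [])))
          (latRows N ((goodTuples N (verticesL N (thickenL rows))).headD [])))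
        (targetL N ((goodTuples N (verticesL N (thickenL rows))).headD []))) :=
      ((babaiPoint_codeFP N).comp ((hB₁.pair hU).pair ((targetL_codeFP N).comp hcand)) :)
    have hsat : CodeFP R bitE (fun rows => satL rows (babaiPoint N (lllRowsL N (latRows N ((goodTuples N (verticesL N (thickenL rows))).headD [])))
        (transU (lllRowsL N (latRows N ((goodTuples N (verticesL N (thickenL rows))).headD [])))
          (latRows N ((goodTuples N (verticesL N (thickenL rows))).headD [])))
        (targetL N ((goodTuples N (verticesL N (thickenL rows))).headD [])))) := (satL_codeFP.comp ((CodeFP.id _).pair hx) :)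
    -- the recursive calls: `any` over `V`, `any` over the levels, the function of dimension `N'`
    let RU := pairE R lmatE
    have hin : CodeFP (pairE RU intE) bitE (fun q => decideL N' (sectionRowsL N q.1.1 q.1.2 q.2)) :=
      ((decideL_codeFP N').comp (sectionRowsL_codeFP N) :)
    have hany1 := any (σ := List LRow × List (List ℤ)) (eσ := RU) (eα := intE) hin
    have hmid : CodeFP (pairE (pairE RU (rawE intE)) vertE) bitE
        (fun q => (levelsOfAnchor N q.1.2 q.2).any fun κ => decideL N' (sectionRowsL N q.1.1.1 q.1.1.2 κ)) :=
      (hany1.comp ((fst _ _).fst'.pair ((levelsOfAnchor_codeFP N).comp ((fst _ _).snd'.pair (snd _ _)))) :)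
    have hany2 := any (σ := (List LRow × List (List ℤ)) × List ℤ) (eσ := pairE RU (rawE intE)) (eα := vertE) hmid
    have hrec : CodeFP R bitE (fun rows => (verticesL N (thickenL rows)).any fun v =>
        (levelsOfAnchor N (colOf (transU (latRows N ((goodTuples N (verticesL N (thickenL rows))).headD []))
          (lllRowsL N (latRows N ((goodTuples N (verticesL N (thickenL rows))).headD [])))) N') v).any fun κ =>
          decideL N' (sectionRowsL N rows (transU (lllRowsL N (latRows N ((goodTuples N (verticesL N (thickenL rows))).headD [])))
            (latRows N ((goodTuples N (verticesL N (thickenL rows))).headD []))) κ)) :=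
      (hany2.comp (((((CodeFP.id _).pair hU)).pair hc).pair hV) :)
    have hbody := hempty.ite (const _ false) (hsat.or hrec)
    exact hbody.congr fun rows => by rw [decideL_succ]

/-- **`decideInstL n` on codes** (`(m, rows) ↦ [m = n] ∧ decideL n rows`). [cite: LenstraHW1983, §1] -/
theorem decideInstL_codeFP (n : ℕ) : CodeFP (pairE natE (rawE rowE)) bitE (decideInstL n) :=
  ((natEq.comp ((fst _ _).pair (const _ n))).and ((decideL_codeFP n).comp (snd _ _))).congr fun _ => rfl

end FixedDimILP

end Literature.Computability.Complexity
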